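import Summits.NavierStokesRegularity.NavierStokesRegularity.Theorems.ScenarioCensusPressureMeter
import HarnessLib

/-!
# LINE «pressure-meter» REV 4 port, part 2/6: §C (second half) `inner_le_of_pressureForce`, `norm_le_of_pressureForce`, `isTypeIAncientMild_two_mul`; §C′ (first
# part) the regularised modulus `rmod`, Kato's inequality `inner_laplacian_le_rmod_mul_laplacian`

Re-homed for the scenario census (typer seat ns-census-typer-1 g8; the cells A1pe / A1p0 / A1pw / A1hw / A1bw / A1gw / A1ma / A1ac are MEMBERS OF RECORD «DECIDED IN
KERNEL IN FILES» of block A2 since census v1.73 (critic idea-crit-3 g7 PASS — no price 00:07:29Z on REV 3, RE-STAMP 00:39:59Z on REV 4; ref ns-census-ref g9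
PRE-CHECK ✓ §14.22 item 33 / §14.24 item 33′; lead-presearch label); this port makes them TREE-decided): VERBATIM PORT of ns-idea-2 LINE g13-3 «pressure-meter»
REV 4, `pub/ideators/ns-idea-2/lines/pressure-meter/line-pressure-meter.rev4.lean` sha16 7fb3f23e01caeb0c (1616 l., lean check rc 0, 0 sorry), split for the
400-line rule into `ScenarioCensusPressureMeter` (§A–§C engine) → `…PressureMeterForce` (§C end, §C′ start) → `…PressureMeterWork` (§C′ maximum principle) →
`…PressureMeterHead` (§C″) → `…PressureMeterRows` (§D rows, nestings) → `…PressureMeterCells` (§D holds + census KEYS).  Lean text VERBATIM in namespace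
`…Theorems.ScenarioCensus.PressureMeter` (the line's `…Lines.PressureMeter` re-homed); port edits: `local notation "E3"` → `abbrev E3` (typer lint: no notation in
port files), `@[conjecture]` on the OPEN rows `Row_A1pd` / `Row_A7s` (typed only, ∃-cells), seven one-line docstrings added (gate lint); `tendsto_typeI_bound`
(`C/√(-s) → 0`, twin of a landed tree lemma in a module the farm does not build — gate lint dedup.landed) is not re-declared and its three uses carry the
one-line Mathlib proof inline (proof text only); the line's `set_option maxHeartbeats 400000 in` on the (θ, σ)-engine is kept as filed.  Statements untouched.

No census VALUE is moved here (the members become TREE-decided by name); NS regularity is NOT proved; (L′) ⟨10661⟩ is untouched; no summit statement is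
proved by this file.
-/

-- the summit and its single problem share the name `NavierStokesRegularity` (D-0017 nested layout)
set_option linter.dupNamespace false

noncomputable section

open Set Function Filter Topology Metric

namespace Summit.NavierStokesRegularity.NavierStokesRegularity.Theorems.ScenarioCensus.PressureMeter

open Literature.Analysis Literature.Analysis.FluidPDE InnerProductSpace
open Summit.NavierStokesRegularity.NavierStokesRegularity.Theorems.SimilarityEnstrophy
  (typeI_ancient_eq_zero_of_rate_lt_one)
open scoped Laplacian InnerProductSpace RealInnerProductSpace ContDiff

/-- **The component maximum principle (far past sent to `-∞`).**  If `⟪e, pressureForce u⟫ ≤ η/((-t)√(-t))`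
on `(-∞, 0) × ℝ³` for a direction `‖e‖ ≤ 1` and a level `η ≥ 0`, then `⟪e, u(t, x)⟫ ≤ 2η/√(-t)`. -/
theorem inner_le_of_pressureForce {C : ℝ} {u : ℝ → E3 → E3} (hu : IsTypeIAncientMild C u) {e : E3}
    (he : ‖e‖ ≤ 1) {η : ℝ} (hη : 0 ≤ η)
    (hres : ∀ t < 0, ∀ x, ⟪e, pressureForce u t x⟫ ≤ η / ((-t) * Real.sqrt (-t))) :
    ∀ t < 0, ∀ x, ⟪e, u t x⟫ ≤ 2 * η / Real.sqrt (-t) := by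
  intro t ht x
  have hev : ∀ᶠ s in atBot, ⟪e, u t x⟫ ≤ C / Real.sqrt (-s) + 2 * η / Real.sqrt (-t) := by
    filter_upwards [Iio_mem_atBot t] with s hs
    have h := inner_le_window hu he hη hres hs ht t ⟨hs.le, le_rfl⟩ x
    have h1 : 0 ≤ (Real.sqrt (-s))⁻¹ := inv_nonneg.2 (Real.sqrt_nonneg _)
    have h2 : 2 * η * ((Real.sqrt (-t))⁻¹ - (Real.sqrt (-s))⁻¹) ≤ 2 * η / Real.sqrt (-t) := by
      rw [div_eq_mul_inv]
      nlinarith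
    linarith
  have hlim : Tendsto (fun s : ℝ => C / Real.sqrt (-s) + 2 * η / Real.sqrt (-t)) atBot
      (𝓝 (0 + 2 * η / Real.sqrt (-t))) := ((show Tendsto (fun s : ℝ => C / Real.sqrt (-s)) atBot (𝓝 0) from (Real.tendsto_sqrt_atTop.comp tendsto_neg_atBot_atTop).const_div_atTop C)).add_const _
  rw [zero_add] at hlim
  exact ge_of_tendsto hlim hev

/-- **The Type-I rate is at most twice the pressure-force level.**  If
`‖pressureForce u(t, x)‖ ≤ η/((-t)√(-t))` on `(-∞, 0) × ℝ³` (`η ≥ 0`), then `‖u(t, x)‖ ≤ 2η/√(-t)`: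
the class element lies in the class with constant `2η`. -/
theorem norm_le_of_pressureForce {C : ℝ} {u : ℝ → E3 → E3} (hu : IsTypeIAncientMild C u)
    {η : ℝ} (hη : 0 ≤ η)
    (hres : ∀ t < 0, ∀ x, ‖pressureForce u t x‖ ≤ η / ((-t) * Real.sqrt (-t))) :
    ∀ t < 0, ∀ x, ‖u t x‖ ≤ 2 * η / Real.sqrt (-t) := by
  intro t ht x
  by_cases h0 : u t x = 0
  · rw [h0, norm_zero]; positivity
  set e : E3 := (‖u t x‖)⁻¹ • u t x with he_def
  have hn : ‖u t x‖ ≠ 0 := norm_ne_zero_iff.2 h0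
  have hnpos : 0 < ‖u t x‖ := norm_pos_iff.2 h0
  have he1 : ‖e‖ = 1 := by
    rw [he_def, norm_smul, norm_inv, norm_norm, inv_mul_cancel₀ hn]
  have hres' : ∀ s < 0, ∀ y, ⟪e, pressureForce u s y⟫ ≤ η / ((-s) * Real.sqrt (-s)) := by
    intro s hs y
    calc ⟪e, pressureForce u s y⟫ ≤ ‖e‖ * ‖pressureForce u s y‖ := real_inner_le_norm _ _
      _ = ‖pressureForce u s y‖ := by rw [he1, one_mul]
      _ ≤ _ := hres s hs y
  have h := inner_le_of_pressureForce hu he1.le hη hres' t ht x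
  have hinner : ⟪e, u t x⟫ = ‖u t x‖ := by
    rw [he_def, real_inner_smul_left, real_inner_self_eq_norm_sq]
    field_simp
  rwa [hinner] at h

/-- A class element with pressure-force level `η` is a class element with Type-I constant `2η`. -/
theorem isTypeIAncientMild_two_mul {C : ℝ} {u : ℝ → E3 → E3} (hu : IsTypeIAncientMild C u)
    {η : ℝ} (hη : 0 ≤ η)
    (hres : ∀ t < 0, ∀ x, ‖pressureForce u t x‖ ≤ η / ((-t) * Real.sqrt (-t))) :
    IsTypeIAncientMild (2 * η) u :=
  ⟨hu.1, hu.2.1, hu.2.2.1, fun t ht x => norm_le_of_pressureForce hu hη hres t ht x⟩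

/-! ## C′. Kato's inequality for the regularised modulus; the streamline-work maximum principle

For `κ > 0` the regularised modulus `ρ_κ(U)(y) = √(κ² + |U(y)|²)` of a `C²` field is `C²`, with
`∇ρ_κ = ⟪U, ∇U⟫/ρ_κ` and KATO'S INEQUALITY `ρ_κ Δρ_κ ≥ ⟪U, ΔU⟫` (from `Δ|U|² = 2⟪ΔU, U⟫ + 2|∇U|²`, tree
`laplacian_inner_self_eq`, the Leibniz rule `Δ(ρ_κ²) = 2ρ_κΔρ_κ + 2|∇ρ_κ|²`, tree
`LoewnerNirenberg.laplacian_smul_apply`, tree `laplacian_const_eq_zero`, and `|∇ρ_κ|² ≤ |∇U|²`).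
Consequently, along a class element,
`∂ₜρ_κ + u·∇ρ_κ − Δρ_κ ≤ ⟪u, pressureForce u⟫/ρ_κ ≤ η(−t)^{-3/2}` under the ONE-SIDED streamline-work
hypothesis `⟪u, F⟫ ≤ η(−t)^{-3/2}|u|`, and the Part-C barrier argument runs with `ρ_κ(u)` in place of
`⟪e, u⟫`; then `κ → 0`, `s → -∞`. -/

/-- The regularised modulus `ρ_κ(U)(y) = √(κ² + ‖U y‖²)`. -/
def rmod (κ : ℝ) (U : E3 → E3) (y : E3) : ℝ := Real.sqrt (κ ^ 2 + ‖U y‖ ^ 2)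

/-- Unfolding the regularised modulus `rmod`. -/
theorem rmod_apply (κ : ℝ) (U : E3 → E3) (y : E3) :
    rmod κ U y = Real.sqrt (κ ^ 2 + ‖U y‖ ^ 2) := rfl

/-- The regularised modulus is positive for `κ ≠ 0`. -/
theorem rmod_pos {κ : ℝ} (hκ : 0 < κ) (U : E3 → E3) (y : E3) : 0 < rmod κ U y :=
  Real.sqrt_pos.2 (by positivity)

/-- `(rmod κ U y)² = κ² + ‖U y‖²`. -/
theorem rmod_sq (κ : ℝ) (U : E3 → E3) (y : E3) : rmod κ U y ^ 2 = κ ^ 2 + ‖U y‖ ^ 2 :=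
  Real.sq_sqrt (by positivity)

/-- `‖U y‖ ≤ rmod κ U y`. -/
theorem norm_le_rmod (κ : ℝ) (U : E3 → E3) (y : E3) : ‖U y‖ ≤ rmod κ U y := by
  rw [rmod_apply]
  calc ‖U y‖ = Real.sqrt (‖U y‖ ^ 2) := (Real.sqrt_sq (norm_nonneg _)).symm
    _ ≤ Real.sqrt (κ ^ 2 + ‖U y‖ ^ 2) := Real.sqrt_le_sqrt (by nlinarith [sq_nonneg κ])

/-- `rmod κ U y ≤ |κ| + ‖U y‖`-type upper bound. -/
theorem rmod_le {κ : ℝ} (hκ : 0 ≤ κ) (U : E3 → E3) (y : E3) : rmod κ U y ≤ κ + ‖U y‖ := by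
  rw [rmod_apply]
  calc Real.sqrt (κ ^ 2 + ‖U y‖ ^ 2) ≤ Real.sqrt ((κ + ‖U y‖) ^ 2) :=
        Real.sqrt_le_sqrt (by nlinarith [norm_nonneg (U y)])
    _ = κ + ‖U y‖ := Real.sqrt_sq (by positivity)

/-- `ρ_κ(U)` is as smooth as `U` (`κ > 0`). -/
theorem contDiff_rmod {κ : ℝ} (hκ : 0 < κ) {U : E3 → E3} {n : ℕ∞} (hU : ContDiff ℝ n U) :
    ContDiff ℝ n (rmod κ U) :=
  (contDiff_const.add (hU.norm_sq ℝ)).sqrt fun y => by positivity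

/-- The derivative of `ρ_κ(U)`: `Dρ_κ(y) a = ⟪U y, DU(y) a⟫ / ρ_κ(y)`. -/
theorem hasFDerivAt_rmod {κ : ℝ} (hκ : 0 < κ) {U : E3 → E3} {y : E3}
    (hU : DifferentiableAt ℝ U y) :
    HasFDerivAt (rmod κ U)
      ((rmod κ U y)⁻¹ • ((innerSL ℝ (U y) : E3 →L[ℝ] ℝ).comp (fderiv ℝ U y))) y := by
  have h1 : HasFDerivAt (fun z => κ ^ 2 + ‖U z‖ ^ 2)
      ((2 : ℕ) • ((innerSL ℝ (U y) : E3 →L[ℝ] ℝ).comp (fderiv ℝ U y))) y :=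
    hU.hasFDerivAt.norm_sq.const_add (κ ^ 2)
  have hne : κ ^ 2 + ‖U y‖ ^ 2 ≠ 0 := by positivity
  have h2 := h1.sqrt hne
  refine h2.congr_fderiv ?_
  ext a
  have hs : Real.sqrt (κ ^ 2 + ‖U y‖ ^ 2) ≠ 0 := (Real.sqrt_pos.2 (by positivity)).ne'
  simp [rmod_apply]
  field_simp

/-- The derivative of the regularised modulus. -/
theorem fderiv_rmod_apply {κ : ℝ} (hκ : 0 < κ) {U : E3 → E3} {y : E3}
    (hU : DifferentiableAt ℝ U y) (a : E3) :
    fderiv ℝ (rmod κ U) y a = (rmod κ U y)⁻¹ * ⟪U y, fderiv ℝ U y a⟫ := by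
  rw [(hasFDerivAt_rmod hκ hU).fderiv]
  simp

/-- **Kato's inequality for the regularised modulus**: `⟪U, ΔU⟫ ≤ ρ_κ(U) Δρ_κ(U)` pointwise, for a
`C²` field `U` and `κ > 0`. -/
theorem inner_laplacian_le_rmod_mul_laplacian {κ : ℝ} (hκ : 0 < κ) {U : E3 → E3}
    (hU : ContDiff ℝ 2 U) (y : E3) :
    ⟪U y, (Δ U) y⟫ ≤ rmod κ U y * (Δ (rmod κ U)) y := by
  set b : OrthonormalBasis (Fin 3) ℝ E3 := EuclideanSpace.basisFun (Fin 3) ℝ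
  have hρ2 : ContDiff ℝ 2 (rmod κ U) := contDiff_rmod hκ hU
  have hρy : 0 < rmod κ U y := rmod_pos hκ U y
  have hUd : DifferentiableAt ℝ U y := (hU.differentiable (by norm_num)) y
  -- (i) Leibniz: `Δ(ρ²) = ρ Δρ + 2 Σ (∂ᵢρ)² + ρ Δρ`
  have h1 : (Δ (fun z => rmod κ U z • rmod κ U z)) y =
      (Δ (rmod κ U)) y • rmod κ U y +
        (2 : ℝ) • ∑ i, (fderiv ℝ (rmod κ U) y (b i)) • (fderiv ℝ (rmod κ U) y (b i)) +
        rmod κ U y • (Δ (rmod κ U)) y :=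
    Literature.Analysis.PDE.LoewnerNirenberg.laplacian_smul_apply hρ2.contDiffAt hρ2.contDiffAt b
  -- (ii) `ρ² = κ² + ⟪U, U⟫`
  have h2 : (fun z => rmod κ U z • rmod κ U z) = (fun _ => κ ^ 2) + fun z => ⟪U z, U z⟫ := by
    funext z
    simp only [smul_eq_mul, Pi.add_apply]
    rw [← sq, rmod_sq, real_inner_self_eq_norm_sq]
  -- (iii) `Δ(κ² + ⟪U, U⟫) = 2⟪ΔU, U⟫ + 2|∇U|²`
  have h3 : (Δ (fun z => rmod κ U z • rmod κ U z)) y =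
      2 * ⟪(Δ U) y, U y⟫ + 2 * frobeniusNormSq (fderiv ℝ U y) := by
    rw [h2, contDiffAt_const.laplacian_add (hU.inner ℝ hU).contDiffAt, laplacian_const_eq_zero,
      zero_add, laplacian_inner_self_eq hU]
  -- (iv) `Σ (∂ᵢρ)² ≤ |∇U|²`
  have h4 : ∑ i, (fderiv ℝ (rmod κ U) y (b i)) • (fderiv ℝ (rmod κ U) y (b i)) ≤
      frobeniusNormSq (fderiv ℝ U y) := by
    rw [frobeniusNormSq_eq_sum b]
    refine Finset.sum_le_sum fun i _ => ?_
    rw [fderiv_rmod_apply hκ hUd, smul_eq_mul]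
    set a : ℝ := ⟪U y, fderiv ℝ U y (b i)⟫ with ha
    set w : E3 := fderiv ℝ U y (b i)
    have hcs : |a| ≤ ‖U y‖ * ‖w‖ := abs_real_inner_le_norm _ _
    have ha2 : a ^ 2 ≤ ‖U y‖ ^ 2 * ‖w‖ ^ 2 := by
      rw [← sq_abs]
      have h0 : 0 ≤ |a| := abs_nonneg _
      nlinarith
    have hU2 : ‖U y‖ ^ 2 ≤ rmod κ U y ^ 2 := by
      rw [rmod_sq]; nlinarith [sq_nonneg κ]
    have e1 : (rmod κ U y)⁻¹ * a * ((rmod κ U y)⁻¹ * a) = a ^ 2 / rmod κ U y ^ 2 := by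
      field_simp
    rw [e1, div_le_iff₀ (by positivity)]
    have hw0 : 0 ≤ ‖w‖ ^ 2 := sq_nonneg _
    nlinarith [mul_le_mul_of_nonneg_right hU2 hw0]
  -- combine
  rw [h1] at h3
  simp only [smul_eq_mul] at h3 h4
  rw [real_inner_comm] at h3
  nlinarith [h3, h4]

end Summit.NavierStokesRegularity.NavierStokesRegularity.Theorems.ScenarioCensus.PressureMeter

end
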